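import Literature.Analysis.FluidPDE.SteadyNavierStokesEnergy
import Literature.Analysis.FunctionSpaces.TorusFourierModes
import Literature.Analysis.FunctionSpaces.TorusFluidGlueProofs

/-!
# Stub `stub_dodgerAssembly` of line lojasiewicz-lamb-floor-ladder (crux stmt-AnomalousDissipation-13038):
# helpers for stub_dodgerAssembly, part 1 — the shear wiggle

Helpers for the stub file `TaylorCertificatesSteadyStatesLoudBoundedStubDodgerAssembly.lean`
(S4b of the line, crux `TaylorCertificates.SteadyStatesLoudBounded`).  The Onsager dodger of the
stub is `u_n = P_{N_n} U + a_n • W_{M_n}` with the **shear wiggle**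
`W_M (x) = √2 cos (2π M x₀) e₁ = Re (e_{k_M}(x) z + e_{-k_M}(x) z)`, `k_M = M e₀ = Pi.single 0 M`,
`z = complexify ((√2/2) e₁)`, i.e. the real trigonometric polynomial
`W = Torus.realTrigPoly S (fun _ ↦ z)` on the shell `S = {k_M, -k_M}`, so that the Parseval
calculus of `TorusTrigPoly` applies verbatim.  To keep the file free of new definitions the
shell, the amplitude and the wiggle enter every lemma through the defining equations
`hS : S = {k_M, -k_M}`, `hz : z = complexify ((√2/2) e₁)`, `hW : W = Torus.realTrigPoly S (fun _ ↦ z)`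
(section variables, instantiated by `rfl` in the stub file).  This file proves:

* `W` is smooth, divergence free (`k · z = 0`), mean zero (`M ≠ 0`), with `‖W x‖ ≤ √2`,
  `∫ ‖W‖² = 1`, `‖∇W‖₂² = 4π² M²`, `(W·∇)W = 0` (it depends on `x₀` only and points along
  `e₁`), and Fourier support `S`;
* the registered sub-goal `dodgerAssembly_partA` packaging these facts as an existence statement
  (the only form in which the stub file uses the wiggle).

All statements are elementary bookkeeping over the tree's torus calculus
(`Literature/Analysis/FunctionSpaces/{TorusCalculus,TorusTrigPoly,TorusFourierModes}.lean`).
-/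

-- `Summit.<Summit>.<Problem>` is the tree's mandated summit-side namespace (CONVENTIONS §2); for this
-- single-conjunct summit the two coincide, so the duplicate is deliberate.
set_option linter.dupNamespace false

noncomputable section

namespace Summit.AnomalousDissipation.AnomalousDissipation.Theorems.SteadyStatesLoudBounded.DodgerAssembly

open MeasureTheory Filter Topology UnitAddTorus
open scoped InnerProductSpace ENNReal
open Literature.Analysis.FunctionSpaces Literature.Analysis.FluidPDE

variable {M : ℕ} {S : Finset (Fin 3 → ℤ)} {z : EuclideanSpace ℂ (Fin 3)}
  {W : UnitAddTorus (Fin 3) → EuclideanSpace ℝ (Fin 3)}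

/-! ## §1 The wiggle frequency `k_M = M e₀` and the shell `S = {k_M, -k_M}` -/

/-- Coordinates of `k_M = Pi.single 0 M`. [folklore] -/
theorem kW_apply (M : ℕ) (i : Fin 3) :
    (Pi.single 0 (M : ℤ) : Fin 3 → ℤ) i = if i = 0 then (M : ℤ) else 0 := by
  simp [Pi.single_apply]

/-- `|k_M|² = M²`. [folklore] -/
theorem freqNormSq_kW (M : ℕ) : Torus.freqNormSq (Pi.single (0 : Fin 3) (M : ℤ)) = (M : ℝ) ^ 2 := by
  simp [Torus.freqNormSq, kW_apply]

/-- `k_M ≠ 0` for `M ≠ 0`. [folklore] -/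
theorem kW_ne_zero (hM : M ≠ 0) : (Pi.single 0 (M : ℤ) : Fin 3 → ℤ) ≠ 0 := by
  intro h
  have h0 := congrFun h 0
  simp at h0
  exact hM h0

/-- `k_M ≠ -k_M` for `M ≠ 0`. [folklore] -/
theorem kW_ne_neg (hM : M ≠ 0) :
    (Pi.single 0 (M : ℤ) : Fin 3 → ℤ) ≠ -(Pi.single 0 (M : ℤ) : Fin 3 → ℤ) := by
  intro h
  have h0 := congrFun h 0
  simp at h0
  omega

section Shell

variable (hS : S = {Pi.single 0 (M : ℤ), -Pi.single 0 (M : ℤ)})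
include hS

/-- Membership in the wiggle shell. [folklore] -/
theorem mem_SW {k : Fin 3 → ℤ} : k ∈ S ↔ k = Pi.single 0 (M : ℤ) ∨ k = -Pi.single 0 (M : ℤ) := by
  subst hS
  simp

/-- The wiggle shell is symmetric. [folklore] -/
theorem sW_symm : ∀ k ∈ S, -k ∈ S := by
  intro k hk
  rw [mem_SW hS] at hk ⊢
  rcases hk with rfl | rfl
  · exact Or.inr rfl
  · exact Or.inl (neg_neg _)

/-- Frequencies in the wiggle shell have `|k|² = M²`. [folklore] -/
theorem freqNormSq_of_mem_SW {k : Fin 3 → ℤ} (hk : k ∈ S) : Torus.freqNormSq k = (M : ℝ) ^ 2 := by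
  rw [mem_SW hS] at hk
  rcases hk with rfl | rfl
  · exact freqNormSq_kW M
  · rw [Torus.freqNormSq_neg, freqNormSq_kW]

/-- Frequencies in the wiggle shell have vanishing `e₁`-component. [folklore] -/
theorem apply_one_of_mem_SW {k : Fin 3 → ℤ} (hk : k ∈ S) : k 1 = 0 := by
  rw [mem_SW hS] at hk
  rcases hk with rfl | rfl <;> simp

/-- The mean mode is not in the wiggle shell (`M ≠ 0`). [folklore] -/
theorem zero_not_mem_SW (hM : M ≠ 0) : (0 : Fin 3 → ℤ) ∉ S := by
  rw [mem_SW hS]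
  push Not
  exact ⟨(kW_ne_zero hM).symm, fun h => kW_ne_zero hM (neg_eq_zero.1 h.symm)⟩

/-- The wiggle shell has at most two elements. [folklore] -/
theorem card_SW_le : S.card ≤ 2 := by
  subst hS
  exact Finset.card_le_two

/-- Sums over the wiggle shell (`M ≠ 0`: two distinct frequencies). [folklore] -/
theorem sum_SW (hM : M ≠ 0) (g : (Fin 3 → ℤ) → ℝ) :
    ∑ k ∈ S, g k = g (Pi.single 0 (M : ℤ)) + g (-Pi.single 0 (M : ℤ)) := by
  subst hS
  exact Finset.sum_pair (kW_ne_neg hM)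

end Shell

/-! ## §2 The amplitude `z = complexify ((√2/2) e₁)` -/

section Amp

variable (hz : z = EuclideanSpace.complexify (EuclideanSpace.single 1 (Real.sqrt 2 / 2)))
include hz

/-- Coordinates of the amplitude `z`. [folklore] -/
theorem zW_apply (i : Fin 3) : z i = if i = 1 then (((Real.sqrt 2 / 2 : ℝ)) : ℂ) else 0 := by
  subst hz
  simp only [EuclideanSpace.complexify_apply, PiLp.single_apply]
  split_ifs <;> simp

/-- `‖z‖ = √2/2`. [folklore] -/
theorem norm_zW : ‖z‖ = Real.sqrt 2 / 2 := by
  rw [hz, EuclideanSpace.norm_complexify, PiLp.norm_single, Real.norm_eq_abs,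
    abs_of_nonneg (by positivity)]

/-- `‖z‖² = 1/2`. [folklore] -/
theorem norm_zW_sq : ‖z‖ ^ 2 = 1 / 2 := by
  rw [norm_zW hz, div_pow, Real.sq_sqrt zero_le_two]
  norm_num

/-- The constant family `z` is conjugate symmetric (`z` is real). [folklore] -/
theorem isConjSymm_zW : Torus.IsConjSymm (fun _ : Fin 3 → ℤ => z) := fun _ => by
  simp only [hz, EuclideanSpace.conjVec_complexify]

end Amp

/-- Transversality `k · z = 0` on the wiggle shell. [folklore] -/
theorem sum_mul_zW_eq_zero (hS : S = {Pi.single 0 (M : ℤ), -Pi.single 0 (M : ℤ)})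
    (hz : z = EuclideanSpace.complexify (EuclideanSpace.single 1 (Real.sqrt 2 / 2)))
    {k : Fin 3 → ℤ} (hk : k ∈ S) : ∑ j, (k j : ℂ) * z j = 0 := by
  simp [zW_apply hz, apply_one_of_mem_SW hS hk]

/-! ## §3 The wiggle `W = Torus.realTrigPoly S (fun _ ↦ z) = √2 cos(2π M x₀) e₁` -/

section Wiggle

variable (hS : S = {Pi.single 0 (M : ℤ), -Pi.single 0 (M : ℤ)})
  (hz : z = EuclideanSpace.complexify (EuclideanSpace.single 1 (Real.sqrt 2 / 2)))
  (hW : W = Torus.realTrigPoly S fun _ => z)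

include hW in
/-- The wiggle is smooth. [folklore] -/
theorem isSmooth_wiggle : Torus.IsSmooth W := by
  subst hW
  exact Torus.isSmooth_realTrigPoly _ _

include hS hz hW in
/-- The wiggle is divergence free. [folklore] -/
theorem isDivFree_wiggle : Torus.IsDivFree W := by
  subst hW
  exact Torus.isDivFree_realTrigPoly fun _ hk => sum_mul_zW_eq_zero hS hz hk

-- adapted from Literature/Analysis/FluidPDE/SteadyGalerkinApprox.lean
-- (`hasZeroMean_realTrigPoly_of_zero_not_mem`, outside this import closure)
include hS hW in
/-- The wiggle has zero mean (`∫ e_k = 0` for `k ≠ 0`). [folklore] -/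
theorem hasZeroMean_wiggle (hM : M ≠ 0) : Torus.HasZeroMean W := by
  subst hW
  show ∫ x, EuclideanSpace.realPart (Torus.trigPoly S (fun _ => z) x) = 0
  rw [EuclideanSpace.realPart.integral_comp_comm
    (Torus.continuous_trigPoly S (fun _ => z)).integrable_unitAddTorus]
  have h : ∫ x, Torus.trigPoly S (fun _ => z) x = 0 := by
    simp_rw [Torus.trigPoly_apply]
    have hint : ∀ k ∈ S, Integrable (fun x : UnitAddTorus (Fin 3) => mFourier k x • z) volume :=
      fun k _ => ((mFourier k).continuous.smul continuous_const).integrable_unitAddTorus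
    rw [integral_finsetSum _ hint]
    refine Finset.sum_eq_zero fun k hk => ?_
    have hk0 : k ≠ 0 := fun h => zero_not_mem_SW hS hM (h ▸ hk)
    rw [integral_smul_const, Torus.integral_mFourier, if_neg hk0, zero_smul]
  rw [h, map_zero]

include hS hz hW in
/-- Pointwise bound `‖W x‖ ≤ √2`. [folklore] -/
theorem norm_wiggle_le (x : UnitAddTorus (Fin 3)) : ‖W x‖ ≤ Real.sqrt 2 := by
  subst hW
  refine (Torus.norm_realTrigPoly_apply_le _ _ x).trans ?_
  rw [Finset.sum_const, nsmul_eq_mul, norm_zW hz]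
  have h2 : (S.card : ℝ) ≤ 2 := by exact_mod_cast card_SW_le hS
  nlinarith [Real.sqrt_nonneg 2]

include hS hz hW in
/-- `∫ ‖W‖² = 1` (Parseval). [folklore] -/
theorem integral_norm_sq_wiggle (hM : M ≠ 0) : ∫ x, ‖W x‖ ^ 2 = 1 := by
  rw [hW, Torus.integral_norm_sq_realTrigPoly (sW_symm hS) (isConjSymm_zW hz), sum_SW hS hM,
    norm_zW_sq hz]
  norm_num

include hS hz hW in
/-- `‖∇W‖₂² = 4π² M²` (Parseval). [folklore] -/
theorem gradNormSq_wiggle (hM : M ≠ 0) : Torus.gradNormSq W = 4 * Real.pi ^ 2 * (M : ℝ) ^ 2 := by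
  rw [Torus.gradNormSq_eq_toReal_eGradNormSq_holds (isSmooth_wiggle hW), hW,
    Torus.toReal_eGradNormSq_realTrigPoly (sW_symm hS) (isConjSymm_zW hz)]
  congr 1
  rw [sum_SW hS hM, freqNormSq_kW, Torus.freqNormSq_neg, freqNormSq_kW, norm_zW_sq hz]
  ring

include hS hz hW in
/-- Fourier coefficients of the wiggle: `z` on the shell, `0` off it. [folklore] -/
theorem mFourierCoeff_wiggle (k : Fin 3 → ℤ) :
    mFourierCoeff (EuclideanSpace.complexify ∘ W) k = if k ∈ S then z else 0 := by
  rw [hW]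
  exact Torus.mFourierCoeff_realTrigPoly (sW_symm hS) (isConjSymm_zW hz) k

include hz hW in
/-- The wiggle points along `e₁`. [folklore] -/
theorem wiggle_apply_of_ne_one (x : UnitAddTorus (Fin 3)) {i : Fin 3} (hi : i ≠ 1) : W x i = 0 := by
  rw [hW, Torus.realTrigPoly_apply_coord, Torus.trigPoly_apply_coord]
  simp [zW_apply hz, hi]

include hS hW in
/-- The wiggle does not depend on `x₁`: `∂₁ W = 0`. [folklore] -/
theorem partialDeriv_one_wiggle (x : UnitAddTorus (Fin 3)) : Torus.partialDeriv 1 W x = 0 := by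
  rw [hW, Torus.partialDeriv_realTrigPoly]
  have h : Torus.realTrigPoly S
      (fun k : Fin 3 → ℤ => (2 * Real.pi * Complex.I * ((k 1 : ℤ) : ℂ)) • z) =
      Torus.realTrigPoly S (0 : (Fin 3 → ℤ) → EuclideanSpace ℂ (Fin 3)) :=
    Torus.realTrigPoly_congr fun k hk => by simp [apply_one_of_mem_SW hS hk]
  rw [h, Torus.realTrigPoly_zero]
  rfl

include hS hz hW in
/-- **The wiggle is a steady Euler flow**: `(W·∇)W = 0`. [folklore] -/
theorem convect_wiggle_wiggle (x : UnitAddTorus (Fin 3)) : Torus.convect W W x = 0 := by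
  rw [Torus.convect, Torus.fderiv_apply_eq_sum_partialDeriv ((isSmooth_wiggle hW).isContDiff (by simp)),
    Fin.sum_univ_three, wiggle_apply_of_ne_one hz hW x (show (0 : Fin 3) ≠ 1 by decide),
    wiggle_apply_of_ne_one hz hW x (show (2 : Fin 3) ≠ 1 by decide), partialDeriv_one_wiggle hS hW]
  simp

end Wiggle

/-! ## §4 The registered sub-goal: shear wiggles exist at every frequency -/

/-- **Registered sub-goal `dodgerAssembly_partA` (shear wiggles).** For every `M ≠ 0` there is a
smooth divergence-free mean-zero field `W` on `T³` (namely `W = √2 cos(2π M x₀) e₁`) with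
`‖W x‖ ≤ √2`, `(W·∇)W = 0` (a steady Euler flow), unit energy `∫ ‖W‖² = 1`, enstrophy
`‖∇W‖₂² = 4π² M²`, and Fourier coefficients supported on the sphere `|k|² = M²`. [folklore] -/
theorem dodgerAssembly_partA : ∀ (M : ℕ), M ≠ 0 →
    ∃ W : UnitAddTorus (Fin 3) → EuclideanSpace ℝ (Fin 3), Torus.IsSmooth W ∧ Torus.IsDivFree W ∧
      Torus.HasZeroMean W ∧ (∀ x, ‖W x‖ ≤ Real.sqrt 2) ∧ (∀ x, Torus.convect W W x = 0) ∧
      ∫ x, ‖W x‖ ^ 2 = 1 ∧ Torus.gradNormSq W = 4 * Real.pi ^ 2 * (M : ℝ) ^ 2 ∧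
      ∀ k : Fin 3 → ℤ, Torus.freqNormSq k ≠ (M : ℝ) ^ 2 →
        mFourierCoeff (EuclideanSpace.complexify ∘ W) k = 0 := by
  intro M hM
  refine ⟨Torus.realTrigPoly {Pi.single 0 (M : ℤ), -Pi.single 0 (M : ℤ)} fun _ =>
      EuclideanSpace.complexify (EuclideanSpace.single 1 (Real.sqrt 2 / 2)),
    isSmooth_wiggle rfl, isDivFree_wiggle (M := M) rfl rfl rfl, hasZeroMean_wiggle (M := M) rfl rfl hM,
    norm_wiggle_le (M := M) rfl rfl rfl, convect_wiggle_wiggle (M := M) rfl rfl rfl,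
    integral_norm_sq_wiggle (M := M) rfl rfl rfl hM, gradNormSq_wiggle (M := M) rfl rfl rfl hM,
    fun k hk => ?_⟩
  rw [mFourierCoeff_wiggle (M := M) rfl rfl rfl k, if_neg]
  exact fun hkS => hk (freqNormSq_of_mem_SW (M := M) rfl hkS)


end Summit.AnomalousDissipation.AnomalousDissipation.Theorems.SteadyStatesLoudBounded.DodgerAssembly

end
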